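import Summits.ABC.ABC.Theorems.IUTThetaPilotAbcOfPilotKummer
import Summits.ABC.IUTFork.Cor312NaiveProvPinnedWitness
import Summits.ABC.IUTFork.LDHGenuineStepV
import HarnessLib

/-!
# Route `IUTThetaPilot`, crux `ThetaPartII` (stmt-ABC-19678): the NON-S binders of the re-based branch-C apex
# `abc_of_pilotKummerIndRelated_of_genEllTwo` are JOINTLY INHABITED at every genuine Θ-volume datum — with S FALSE there

Companion (proof-only, composition BY NAME) of `IUTThetaPilotAbcOfPilotKummer.lean` (abc-iut-w4-d001 g3, p429014), answering
the C3/C4 vacuity-audit request of abc-iut-L6-t24 (HOME/INBOX 2026-08-26T06:41:12Z): for EVERY genuine Θ-volume datum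
`T : Cor22.ThetaVolumeDatumAt P l` there EXIST data families `(TI, St, Pc, ρ, qK)` carrying ALL the non-S side binders of the
apex at `T` — provenance `Cor312Prov.IsSettingOf T.D Pc`, `BridgeHyps Pc`, Thm. 3.11 (ii)(b) `KummerB` at column `n`, the three
pins `PinnedRegions3`, and the Θ-side reading `Pc.negLogTheta ≤ ↑T.negLogTheta` — and at which the residual
**S = `PilotKummerIndRelated` FAILS** (as it must: otherwise the apex would prove abc outright). Source of the witness:
abc-iut-w4-d026's provenance-tied pinned countermodel `Cor312Vol.NaiveProv.pinned_countermodel_isSettingOf (D)` (interface +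
provenance level, over `Thm311.Real.thetaIndexOfInitial D`; typed Thm. 3.11 TRUE there, `−|log(Θ)| = w̄·(−|log(q)|)` with
`w̄ = stepVWeight = (ℓ⋇+1)(2ℓ⋇+1)/6`), at `D := T.D`; the Θ-side reading then holds by the FREE INEQUALITY of the genuine
input (abc-iut-S2's `DHData.free_inequality_input : −deĝ̲_lgp(P_Θ) ≤ negLogThetaNonarch I`, abc-iut-c312-d1's closed form
`DHData.ndegLgp_thetaPilot_eq : deĝ̲_lgp(P_Θ) = ((l+1)/24)·deĝ̲(𝔮)`, abc-iut-c312-8's `Cor312Prov.ndeg_qDivisor_pilotData_eq_logq`,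
and `l = 2ℓ⋇ + 1`): `w̄·(−(1/2l)·log q) = −((l+1)/24)·log q = −deĝ̲_lgp(P_Θ) ≤ −|log(Θ)|^{non}(T) < −|log(Θ)|(T)`.

READING (neutral): the apex's content therefore sits ENTIRELY in `hS` (+ `hvol` off the slot-constant regime + `GenEllTwo`):
every other binder family is inhabited at genuine data by a witness at which S is false. Nothing here asserts abc, S, or
[IUTchIII] Cor. 3.12, or takes a side on any author; interface + provenance level witness, no judgement on print.
[claim: Mochizuki2012, status: disputed] for the IUT sentences referred to.
-/

set_option linter.dupNamespace false

noncomputable section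

namespace Summit.ABC.ABC.Theorems.ThetaPartII

open Literature.NumberTheory.DiophantineGeometry Literature.NumberTheory.DiophantineGeometry.GenEll
open Literature.IUT.LogVolume Literature.IUT.HodgeTheaters Summit.ABC.IUTFork Summit.ABC.IUTFork.Thm311
open Summit.ABC.IUTFork.Cor312Vol

/-- **The Step-(v) weight times `−|log(q)|` IS `−deĝ̲_lgp(P_Θ)`** for the pilot data of an initial Θ-datum `D`:
`stepVWeight(l⋇)·(−(1/2l)·log q) = −((l+1)/24)·log q = −deĝ̲_lgp(P_Θ)` (`l = 2l⋇+1`, `(l⋇+1)(2l⋇+1)/6 · 1/(2l) = (l+1)/24`).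
Pure arithmetic over abc-iut-c312-d1's `DHData.ndegLgp_thetaPilot_eq` and abc-iut-c312-8's `ndeg_qDivisor_pilotData_eq_logq`.
[cite: DupuyHilado2025, §3.3] -/
theorem stepVWeight_mul_neg_absLogq_eq {F K Fbar : Type} [Field F] [NumberField F] [Field K] [NumberField K]
    [Algebra F K] [Field Fbar] [Algebra F Fbar] [Algebra K Fbar] {E : WeierstrassCurve F} [E.IsElliptic] {l : ℕ}
    {Pb : BadPlacePredicates K} (D : InitialThetaData F K Fbar E l Pb) :
    Cor312.stepVWeight (Thm311.Real.thetaIndexOfInitial D) * (-Cor312Prov.absLogq D) =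
      -LgpDivisor.ndegLgp (ThetaData.pilotData D).thetaPilot := by
  have hl : l = 2 * Thm311.Real.lstarOf D + 1 := Thm311.Real.l_eq_two_mul_lstarOf_add_one D
  have hls : (Thm311.Real.thetaIndexOfInitial D).lstar = Thm311.Real.lstarOf D := rfl
  have hne : Thm311.Real.lstarOf D ≠ 0 := by
    have := (Thm311.Real.thetaIndexOfInitial D).two_le_lstar
    rw [hls] at this
    omega
  rw [Cor312.stepVWeight, hls, avgWeightAt_sqWeights _ hne, DHData.ndegLgp_thetaPilot_eq, ThetaData.pilotData_l,
    Cor312Prov.ndeg_qDivisor_pilotData_eq_logq, Cor312Prov.absLogq]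
  set k : ℕ := Thm311.Real.lstarOf D with hk
  have hlR : (l : ℝ) = 2 * (k : ℝ) + 1 := by rw [hl]; push_cast; ring
  rw [hlR]
  have hpos : (0 : ℝ) < 2 * (2 * (k : ℝ) + 1) := by positivity
  field_simp
  ring

/-- **NON-VACUITY OF THE NON-S BINDERS AT EVERY GENUINE DATUM (with S false there).** For every genuine Θ-volume datum `T`
at `(P, l)` there are an index `TI`, a lattice situation `St`, a Cor.-3.12 setting `Pc` over it, a region reading `ρ` and a
q-datum `qK` such that: `Pc` is the setting OF `T.D` (`IsSettingOf`), the bridge hypotheses hold, Thm. 3.11 (ii)(b) holds at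
column `n`, the three pins hold, the Θ-side reading `Pc.negLogTheta ≤ ↑T.negLogTheta` holds — i.e. ALL side binders of
`abc_of_pilotKummerIndRelated_of_genEllTwo` / `vojta…` at `T` — and `¬ PilotKummerIndRelated St Pc ρ qK`. Witness:
abc-iut-w4-d026's `NaiveProv.pinned_countermodel_isSettingOf T.D` (typed Thm. 3.11 true; honest `j²`-scaling
`−|log(Θ)| = stepVWeight·(−|log(q)|)`), the Θ-side reading from `stepVWeight_mul_neg_absLogq_eq` + abc-iut-S2's free inequality
`DHData.free_inequality_input` + `archLogTheta > 0`. Interface + provenance level; no judgement on print; S is neither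
asserted nor denied in general — it FAILS at this witness. [claim: Mochizuki2012, status: disputed] -/
theorem exists_sideData_of_datum {P : NFPoint} {l : ℕ} (T : Cor22.ThetaVolumeDatumAt P l) :
    ∃ (TI : ThetaIndex) (St : LatticeSituation TI) (Pc : Cor312.Setting St.toSituation)
      (ρ : (∀ v : TI.V, v ∈ TI.Vbad → Set (St.L.StarPacket v)) → ∀ (j : TI.Label) (vQ : TI.VQ), Set (St.L.Packet j vQ))
      (qK : ∀ v : TI.V, v ∈ TI.Vbad → Set (St.L.StarPacket v)),
      (letI := T.instFieldF; letI := T.instNumberFieldF; letI := T.instAlgebraF; letI := T.instFieldK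
       letI := T.instNumberFieldK; letI := T.instAlgebraK; letI := T.instFieldFbar; letI := T.instAlgebraFbar
       letI := T.instAlgebraKFbar; letI := T.instIsElliptic
       Cor312Prov.IsSettingOf T.D Pc) ∧
      BridgeHyps Pc ∧ (St.col Pc.n).KummerB (St.D Pc.n) ∧ PinnedRegions3 St Pc ρ qK ∧
      Pc.negLogTheta ≤ ((T.negLogTheta : ℝ) : WithTop ℝ) ∧ ¬ PilotKummerIndRelated St Pc ρ qK := by
  letI := T.instFieldF; letI := T.instNumberFieldF; letI := T.instAlgebraF; letI := T.instFieldK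
  letI := T.instNumberFieldK; letI := T.instAlgebraK; letI := T.instFieldFbar; letI := T.instAlgebraFbar
  letI := T.instAlgebraKFbar; letI := T.instIsElliptic
  obtain ⟨F₁, Pc, ρ, qK, hSet, hThm, -, -, -, -, hB, -, hΘeq, hpin, -, -, -, hres, -⟩ :=
    NaiveProv.pinned_countermodel_isSettingOf T.D
  refine ⟨_, F₁.toLatticeSituation, Pc, ρ, qK, hSet, hB, GluedMonoids.kummerB_of_statement F₁ hThm Pc.n, hpin, ?_,
    hres⟩
  -- the Θ-side reading: `stepVWeight·(−|log(q)|) = −deĝ̲_lgp(P_Θ) ≤ −|log(Θ)|^{non}(T) ≤ −|log(Θ)|(T)`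
  rw [hΘeq, hSet.negLogQ_eq, stepVWeight_mul_neg_absLogq_eq]
  refine WithTop.coe_le_coe.mpr ?_
  have hX : T.I.X = ThetaData.pilotData T.D := T.isVolumeInputOf.X_eq
  have hfree := DHData.free_inequality_input T.I
  rw [hX] at hfree
  have harch := ThetaVolumeInput.archLogTheta_pos T.I.l
  show -LgpDivisor.ndegLgp (ThetaData.pilotData T.D).thetaPilot ≤ T.I.negLogThetaNonarch + ThetaVolumeInput.archLogTheta T.I.l
  linarith

end Summit.ABC.ABC.Theorems.ThetaPartII

end
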